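import Summits.BirchSwinnertonDyer.BirchSwinnertonDyer.Theorems.ErratumRoadFiveNonSurjCornerKolyJSwapAssembly
import Summits.BirchSwinnertonDyer.BirchSwinnertonDyer.Theorems.ErratumRoadFiveNonSurjCornerKolyJCebotarevAtFive
import HarnessLib

/-!
# Route `ErratumRoadFive` (rung K2), crux child `NonSurjCornerKolyJ` (item stmt-BirchSwinnertonDyer-19947), registered stub
# `stub_kolyJ_max`: the SWAP HALF of the reading spelled out as NAMED CONCRETE INPUTS — «stub ⟸ {swap inputs, hlev}»
# (cell `bsd-stepL`, seat `bsd-stepL-corner-p1` g8; `--supports stmt-BirchSwinnertonDyer-19947`)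

WHAT. `nonSurjCornerKolyJ_max_of_swap_of_perLevel'` (p514959) reads the stub ⟸ {hswap, hlev}. Here `hswap` is REPLACED by the
concrete per-frame inputs from which the kernel produces it (`hswap_of_swapSupply` p518715 ∘ `exists_deep_of_swapFamilies_of_irr_of_neg'`
p512423, with the `−1` binder DISCHARGED at `p = 5` by `GaloisImage.exists_smul_eq_neg_five_of_irr` p513497): per corner frame,
(i) a prime `q ∣ d_K`, `q ∤ N_E`, `q ≠ p` (Gross's disjointness — any prime factor of the Heegner `d_K`); (ii) AT `p = 7` ONLY,
`−1 ∈ ρ̄_{E,7}(Γ_ℚ)` (a genuine restriction there); (iii) Kolyvagin–Heegner data at every admissible conductor (Heegner points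
of conductor prime to `N`; conductor `1` is Darmon 3.6 in the tree); (iv) for all `M e` and every family `D` on the admissible
conductors over index `≥ M + 1` with all `P(D s) ∈ p^M E`: the level-`p` SWAP INPUTS — a complex conjugation `τ ≠ 1`, a
transverse structure `𝒯` on `H¹(K, E[p])`, signs `eb` (Gross 5.4), the duality count `hPT` at a relaxed Kolyvagin prime
(Thm. 5.1 ∕ Lemma 5.2 (iii)), the local Tate pairing package on `H¹(K_λ, E[p])` (`pair`, perfectness `hperf`, reciprocity
`hrec`), and the level-`p` classes `κ̄` (`κb`) with `hκSel` (sign + `𝓕(s)`-membership), `h44c` (Prop. 4.4, non-vanishing form,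
Kolyvagin primes) and `hκ0` («`κ̄ ≠ 0 ↔ p^{M+1} ∤ P`») — of which `κb`∕`hκ0` are supplied by `exists_levelOne_avatar` (p516360)
and `h44c`∕sign∕Kummer-membership reduce to level-`(M+1)` statements by `…KolyJLevelTransport` (p517266∕p517808).
**`nonSurjCornerKolyJ_max_of_swapInputs_of_perLevel`**: stub VERBATIM ⟸ {hswapIn (i)–(iv), hlev}. HONEST FRAMING: one theorem;
CONDITIONAL; no stub closes; nothing about any curve; T7.
References: [McCallumLMS1991] §2 Prop. 2.2, §3 Cor. 3.2, §4 Prop. 4.4, Cor. 4.5, §5 Prop. 5.2, Lemma 5.3; [BurungaleEtAl2026]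
Prop. 2.2.1; [Jetchev2008] Thm. 1.4, Lemma 5.1; [GrossLMS1991] §3, Prop. 5.4; [Serre1972] §2.6.
-/

set_option autoImplicit false

noncomputable section

open scoped Classical NumberField

namespace Summit.BirchSwinnertonDyer.Rank1Residual.X11b.Three.Koly

open WeierstrassCurve IsDedekindDomain NumberField Literature.NumberTheory.EllipticCurves
  Literature.NumberTheory.EllipticCurves.ModularForms Literature.NumberTheory.EllipticCurves.Jetchev2008
  Literature.NumberTheory.EllipticCurves.Rank1Residual
  Literature.NumberTheory.GaloisRepresentations
  Literature.NumberTheory.GaloisRepresentations.DiscreteGaloisModule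
  Summit.BirchSwinnertonDyer.Rank1Residual Summit.BirchSwinnertonDyer.Rank1Residual.X11b
  Summit.BirchSwinnertonDyer.Rank1Residual.JET

/-- **`stub_kolyJ_max` ⟸ {the concrete swap inputs, hlev}** — see the module docstring for (i)–(iv). Proof:
`nonSurjCornerKolyJ_max_of_swap_of_perLevel'` with `hswap := hswap_of_swapSupply … (exists_deep_of_swapFamilies_of_irr_of_neg' …)`,
the `−1 ∈ ρ̄(Γ_ℚ)` input produced at `p = 5` by `GaloisImage.exists_smul_eq_neg_five_of_irr` and taken from (ii) at `p = 7`.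
CONDITIONAL; nothing booked. [cite: McCallumLMS1991, §5 Prop. 5.2 (p. 304)] [cite: BurungaleEtAl2026, Prop. 2.2.1 (§2.2)]
[cite: Jetchev2008, Thm. 1.4 (p. 812)] -/
theorem nonSurjCornerKolyJ_max_of_swapInputs_of_perLevel
    (hswapIn : ∀ (W : WeierstrassCurve ℚ) [W.IsElliptic] [W.IsGloballyMinimal] [NeZero (W.conductorNorm ℤ)]
      (p : ℕ) [Fact p.Prime] (K : Type) [Field K] [NumberField K]
      (Dt : ModularParametrizationData W (W.conductorNorm ℤ)) (β : ℤ) (ι : K →+* ℂ),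
      p ∣ W.tamagawaProduct →
      ClassX11b W p → ¬ Surj W p → (p = 5 ∨ p = 7) → p ∣ padicValInt p W.minimalDiscriminantInt →
      ¬ Ram W p → IsImaginaryQuadratic K → 4 < (NumberField.discr K).natAbs →
      SatisfiesHeegnerHypothesis (W.conductorNorm ℤ) K → SatisfiesHeegnerHypothesis p K →
      (4 * (W.conductorNorm ℤ : ℤ)) ∣ β ^ 2 - NumberField.discr K → ¬ (p : ℤ) ∣ Dt.c →
      (∃ q : ℕ, q.Prime ∧ (q : ℤ) ∣ NumberField.discr K ∧ ¬ q ∣ W.conductorNorm ℤ ∧ q ≠ p) ∧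
      (p = 7 → ∃ γ : Field.absoluteGaloisGroup ℚ, ∀ P : geomTorsion W p, γ • P = -P) ∧
      (∀ m : ℕ, Squarefree m → (∀ q ∈ m.primeFactors, Zhang2014.IsKolyvaginPrime (W.conductorNorm ℤ) W K p q) →
        Nonempty (KolyvaginHeegnerData Dt β ι m)) ∧
      (∀ (M e : ℕ) (D : ∀ s : {m : ℕ // Squarefree m ∧ ∀ q ∈ m.primeFactors,
            Zhang2014.IsKolyvaginPrime (W.conductorNorm ℤ) W K p q ∧ M + 1 ≤ Zhang2014.kolyvaginIndex W p q},
          KolyvaginHeegnerData Dt β ι s.1), (∀ s, PDiv (D s) p M) →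
        ∃ (τ : K ≃ₐ[ℚ] K) (_ : τ ≠ 1)
          (𝒯 : SelmerStructure ((W.baseChange K).torsionGaloisModule ((p ^ 1 : ℕ) : ℤ))) (eb : ℕ → Bool)
          (Z : Type) (_ : AddCommGroup Z)
          (pair : ∀ v : HeightOneSpectrum (𝓞 K),
          galoisCohomology (((W.baseChange K).torsionGaloisModule ((p ^ 1 : ℕ) : ℤ)).toLocal (Sum.inr v)) 1 →+
          galoisCohomology (((W.baseChange K).torsionGaloisModule ((p ^ 1 : ℕ) : ℤ)).toLocal (Sum.inr v)) 1 →+ Z)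
          (κb : {m : ℕ // Squarefree m ∧ ∀ q ∈ m.primeFactors,
            Zhang2014.IsKolyvaginPrime (W.conductorNorm ℤ) W K p q ∧ M + 1 ≤ Zhang2014.kolyvaginIndex W p q} →
          galoisCohomology ((W.baseChange K).torsionGaloisModule ((p ^ 1 : ℕ) : ℤ)) 1),
          (∀ (m ℓ : ℕ), ℓ.Prime → ¬ ℓ ∣ m → eb (m * ℓ) = !eb m) ∧
          (∀ (s : {m : ℕ // Squarefree m ∧ ∀ q ∈ m.primeFactors,
            Zhang2014.IsKolyvaginPrime (W.conductorNorm ℤ) W K p q ∧ M + 1 ≤ Zhang2014.kolyvaginIndex W p q})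
          (ℓ : ℕ), Zhang2014.IsKolyvaginPrime (W.conductorNorm ℤ) W K p ℓ →
          M + 1 ≤ Zhang2014.kolyvaginIndex W p ℓ → ¬ ℓ ∣ s.1 →
          ∀ v : HeightOneSpectrum (𝓞 K), (ℓ : 𝓞 K) ∈ v.asIdeal → ∀ b : Bool,
          Nat.card ((signPart W K τ ((p ^ 1 : ℕ) : ℤ) (if b then 1 else -1)
              ((selmerF W ((p ^ 1 : ℕ) : ℤ) 𝒯 (placesDividing K s.1)).relaxedAt {v}).selmerGroup).map
            (galoisCohomology.localization ((W.baseChange K).torsionGaloisModule ((p ^ 1 : ℕ) : ℤ))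
              (Sum.inr v) 1)) = p ^ 1) ∧
          (∀ (ℓ : ℕ), Zhang2014.IsKolyvaginPrime (W.conductorNorm ℤ) W K p ℓ →
          M + 1 ≤ Zhang2014.kolyvaginIndex W p ℓ → ∀ v : HeightOneSpectrum (𝓞 K), (ℓ : 𝓞 K) ∈ v.asIdeal →
          ∀ (e : ℤ), (e = 1 ∨ e = -1) →
          ∀ (x y : galoisCohomology ((W.baseChange K).torsionGaloisModule ((p ^ 1 : ℕ) : ℤ)) 1),
          conjAct W τ ((p ^ 1 : ℕ) : ℤ) x = e • x → conjAct W τ ((p ^ 1 : ℕ) : ℤ) y = e • y →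
          galoisCohomology.localization ((W.baseChange K).torsionGaloisModule ((p ^ 1 : ℕ) : ℤ)) (Sum.inr v) 1 x ∈
            𝒯 (Sum.inr v) →
          galoisCohomology.localization ((W.baseChange K).torsionGaloisModule ((p ^ 1 : ℕ) : ℤ)) (Sum.inr v) 1 y ∈
            (W.baseChange K).kummerSelmerStructure ((p ^ 1 : ℕ) : ℤ) (Sum.inr v) →
          galoisCohomology.localization ((W.baseChange K).torsionGaloisModule ((p ^ 1 : ℕ) : ℤ)) (Sum.inr v) 1 x ≠ 0 →
          galoisCohomology.localization ((W.baseChange K).torsionGaloisModule ((p ^ 1 : ℕ) : ℤ)) (Sum.inr v) 1 y ≠ 0 →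
          pair v (galoisCohomology.localization ((W.baseChange K).torsionGaloisModule ((p ^ 1 : ℕ) : ℤ)) (Sum.inr v) 1 x)
            (galoisCohomology.localization ((W.baseChange K).torsionGaloisModule ((p ^ 1 : ℕ) : ℤ)) (Sum.inr v) 1 y) ≠ 0) ∧
          (∀ (s : {m : ℕ // Squarefree m ∧ ∀ q ∈ m.primeFactors,
            Zhang2014.IsKolyvaginPrime (W.conductorNorm ℤ) W K p q ∧ M + 1 ≤ Zhang2014.kolyvaginIndex W p q})
          (ℓ₀ ℓ : ℕ), Zhang2014.IsKolyvaginPrime (W.conductorNorm ℤ) W K p ℓ₀ → M + 1 ≤ Zhang2014.kolyvaginIndex W p ℓ₀ →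
          Zhang2014.IsKolyvaginPrime (W.conductorNorm ℤ) W K p ℓ → M + 1 ≤ Zhang2014.kolyvaginIndex W p ℓ →
          ¬ ℓ₀ ∣ s.1 → ¬ ℓ ∣ s.1 → ℓ ≠ ℓ₀ →
          ∀ v₀ : HeightOneSpectrum (𝓞 K), (ℓ₀ : 𝓞 K) ∈ v₀.asIdeal →
          ∀ v : HeightOneSpectrum (𝓞 K), (ℓ : 𝓞 K) ∈ v.asIdeal → ∀ (b : Bool)
          (a c : galoisCohomology ((W.baseChange K).torsionGaloisModule ((p ^ 1 : ℕ) : ℤ)) 1),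
          a ∈ signPart W K τ ((p ^ 1 : ℕ) : ℤ) (if b then 1 else -1)
            ((selmerF W ((p ^ 1 : ℕ) : ℤ) 𝒯 (placesDividing K s.1)).relaxedAt {v₀}).selmerGroup →
          c ∈ signPart W K τ ((p ^ 1 : ℕ) : ℤ) (if b then 1 else -1)
            (selmerF W ((p ^ 1 : ℕ) : ℤ) 𝒯 (placesDividing K (s.1 * ℓ₀ * ℓ))).selmerGroup →
          pair v₀ (galoisCohomology.localization ((W.baseChange K).torsionGaloisModule ((p ^ 1 : ℕ) : ℤ))
              (Sum.inr v₀) 1 c)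
            (galoisCohomology.localization ((W.baseChange K).torsionGaloisModule ((p ^ 1 : ℕ) : ℤ))
              (Sum.inr v₀) 1 a) +
          pair v (galoisCohomology.localization ((W.baseChange K).torsionGaloisModule ((p ^ 1 : ℕ) : ℤ))
              (Sum.inr v) 1 c)
            (galoisCohomology.localization ((W.baseChange K).torsionGaloisModule ((p ^ 1 : ℕ) : ℤ))
              (Sum.inr v) 1 a) = 0) ∧
          (∀ s, κb s ∈ signPart W K τ ((p ^ 1 : ℕ) : ℤ) (if eb s.1 then 1 else -1)
          (selmerF W ((p ^ 1 : ℕ) : ℤ) 𝒯 (placesDividing K s.1)).selmerGroup) ∧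
          (∀ (s s' : {m : ℕ // Squarefree m ∧ ∀ q ∈ m.primeFactors,
            Zhang2014.IsKolyvaginPrime (W.conductorNorm ℤ) W K p q ∧ M + 1 ≤ Zhang2014.kolyvaginIndex W p q}) (ℓ : ℕ),
          Zhang2014.IsKolyvaginPrime (W.conductorNorm ℤ) W K p ℓ → M + 1 ≤ Zhang2014.kolyvaginIndex W p ℓ →
          ¬ ℓ ∣ s.1 → s'.1 = s.1 * ℓ → ∀ v : HeightOneSpectrum (𝓞 K), (ℓ : 𝓞 K) ∈ v.asIdeal →
          (galoisCohomology.localization ((W.baseChange K).torsionGaloisModule ((p ^ 1 : ℕ) : ℤ)) (Sum.inr v) 1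
              (κb s') = 0 ↔
            galoisCohomology.localization ((W.baseChange K).torsionGaloisModule ((p ^ 1 : ℕ) : ℤ)) (Sum.inr v) 1
              (κb s) = 0)) ∧
          (∀ s, κb s ≠ 0 ↔ ¬ PDiv (D s) p (M + 1))))
    (hlev : ∀ (W : WeierstrassCurve ℚ) [W.IsElliptic] [W.IsGloballyMinimal] [NeZero (W.conductorNorm ℤ)]
      (p : ℕ) [Fact p.Prime] (K : Type) [Field K] [NumberField K]
      (Dt : ModularParametrizationData W (W.conductorNorm ℤ)) (β : ℤ) (ι : K →+* ℂ),
      p ∣ W.tamagawaProduct →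
      ClassX11b W p → ¬ Surj W p → (p = 5 ∨ p = 7) → p ∣ padicValInt p W.minimalDiscriminantInt →
      ¬ Ram W p → IsImaginaryQuadratic K → 4 < (NumberField.discr K).natAbs →
      SatisfiesHeegnerHypothesis (W.conductorNorm ℤ) K → SatisfiesHeegnerHypothesis p K →
      (4 * (W.conductorNorm ℤ : ℤ)) ∣ β ^ 2 - NumberField.discr K → ¬ (p : ℤ) ∣ Dt.c →
      ∀ (v : HeightOneSpectrum (𝓞 ℚ)) (k n : ℕ) (d : KolyvaginHeegnerData Dt β ι n), Squarefree n →
        (∀ ℓ ∈ n.primeFactors, Zhang2014.IsKolyvaginPrime (W.conductorNorm ℤ) W K p ℓ) →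
        (if divOrd d p < Zhang2014.levelIndex W p n then divOrd d p else (⊤ : ℕ∞)) < (k : ℕ∞) →
        padicValNat p (W.tamagawaNumberAt v) ≤ k →
        (k : ℕ∞) + (if divOrd d p < Zhang2014.levelIndex W p n then divOrd d p else ⊤) ≤
          Zhang2014.levelIndex W p n →
        (padicValNat p (W.tamagawaNumberAt v) : ℕ∞) ≤
          (if divOrd d p < Zhang2014.levelIndex W p n then divOrd d p else ⊤)) :
    ∀ (W : WeierstrassCurve ℚ) [W.IsElliptic] [W.IsGloballyMinimal] [NeZero (W.conductorNorm ℤ)]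
      (p : ℕ) [Fact p.Prime] (K : Type) [Field K] [NumberField K]
      (Dt : ModularParametrizationData W (W.conductorNorm ℤ)) (β : ℤ) (ι : K →+* ℂ),
      p ∣ W.tamagawaProduct →
      ClassX11b W p → ¬ Surj W p → (p = 5 ∨ p = 7) → p ∣ padicValInt p W.minimalDiscriminantInt →
      ¬ Ram W p → IsImaginaryQuadratic K → 4 < (NumberField.discr K).natAbs →
      SatisfiesHeegnerHypothesis (W.conductorNorm ℤ) K → SatisfiesHeegnerHypothesis p K →
      (4 * (W.conductorNorm ℤ : ℤ)) ∣ β ^ 2 - NumberField.discr K → ¬ (p : ℤ) ∣ Dt.c →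
      ∀ (v : HeightOneSpectrum (𝓞 ℚ)) (s : ℕ), s ≤ padicValNat p (W.tamagawaNumberAt v) →
        ∀ (n : ℕ) (d : KolyvaginHeegnerData Dt β ι n), Squarefree n →
          (∀ ℓ ∈ n.primeFactors, Zhang2014.IsKolyvaginPrime (W.conductorNorm ℤ) W K p ℓ ∧
            s ≤ Zhang2014.kolyvaginIndex W p ℓ) → PDiv d p s := by
  refine nonSurjCornerKolyJ_max_of_swap_of_perLevel' ?_ hlev
  intro W _ _ _ p _ K _ _ Dt β ι htam hX hns h57 hv hnr hK' hd hHN hHp hβ hc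
  obtain ⟨⟨q, hq, hqd, hqN, hqp⟩, hneg7, hdata, hsup⟩ :=
    hswapIn W p K Dt β ι htam hX hns h57 hv hnr hK' hd hHN hHp hβ hc
  have hneg : ∃ γ : Field.absoluteGaloisGroup ℚ, ∀ P : geomTorsion W p, γ • P = -P := by
    rcases h57 with rfl | rfl
    · exact GaloisImage.exists_smul_eq_neg_five_of_irr W hX.2.2.2
    · exact hneg7 rfl
  refine hswap_of_swapSupply p hdata ?_
  intro M e D hall c hcadm hc0
  obtain ⟨τ, hτ, 𝒯, eb, Z, instZ, pair, κb, heb, hPT, hperf, hrec, hκSel, h44c, hκ0⟩ := hsup M e D hall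
  letI : AddCommGroup Z := instZ
  exact exists_deep_of_swapFamilies_of_irr_of_neg' W K p Dt β ι hK' hX.2.1 hX.2.2.2 hneg hq hqd hqN hqp τ hτ
    1 (M + 1) e le_rfl 𝒯 D eb heb hPT pair hperf hrec κb hκSel h44c hκ0 c hcadm hc0

/-- **`stub_upper3_jetchevMax` (19111 Upper kit) ⟸ {the concrete swap inputs at `p = 3`, hlev}** — as
`nonSurjCornerKolyJ_max_of_swapInputs_of_perLevel`, with the `−1` input FREE at `3` (`exists_deep_of_swapFamilies_of_irr_three'`,
shim3b's `exists_sq_smul_eq_neg_three_of_irr`): per (T4″)@3 corner frame, (i) a prime `q ∣ d_K`, `q ∤ N_E`, `q ≠ 3`,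
(iii) data at admissible conductors, (iv) the level-`3` swap inputs for every family. CONDITIONAL; nothing booked.
[cite: McCallumLMS1991, §5 Prop. 5.2 (p. 304)] [cite: BurungaleEtAl2026, Prop. 2.2.1 (§2.2)] [cite: Serre1972, §2.5] -/
theorem cornerUpper3_jetchevMax_of_swapInputs_of_perLevel
    (hswapIn : ∀ (W : WeierstrassCurve ℚ) [W.IsElliptic] [W.IsGloballyMinimal] [NeZero (W.conductorNorm ℤ)]
      (K : Type) [Field K] [NumberField K]
      (Dt : ModularParametrizationData W (W.conductorNorm ℤ)) (β : ℤ) (ι : K →+* ℂ),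
      ClassX11b W 3 → ¬ Surj W 3 →
      IsImaginaryQuadratic K → SatisfiesHeegnerHypothesis (W.conductorNorm ℤ) K →
      Odd (NumberField.discr K) →
      (4 * (W.conductorNorm ℤ : ℤ)) ∣ β ^ 2 - NumberField.discr K → ¬ (3 : ℤ) ∣ Dt.c →
      (∃ q : ℕ, q.Prime ∧ (q : ℤ) ∣ NumberField.discr K ∧ ¬ q ∣ W.conductorNorm ℤ ∧ q ≠ 3) ∧
      (∀ m : ℕ, Squarefree m → (∀ q ∈ m.primeFactors, Zhang2014.IsKolyvaginPrime (W.conductorNorm ℤ) W K 3 q) →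
        Nonempty (KolyvaginHeegnerData Dt β ι m)) ∧
      (∀ (M e : ℕ) (D : ∀ s : {m : ℕ // Squarefree m ∧ ∀ q ∈ m.primeFactors,
            Zhang2014.IsKolyvaginPrime (W.conductorNorm ℤ) W K 3 q ∧ M + 1 ≤ Zhang2014.kolyvaginIndex W 3 q},
          KolyvaginHeegnerData Dt β ι s.1), (∀ s, PDiv (D s) 3 M) →
        ∃ (τ : K ≃ₐ[ℚ] K) (_ : τ ≠ 1)
          (𝒯 : SelmerStructure ((W.baseChange K).torsionGaloisModule ((3 ^ 1 : ℕ) : ℤ))) (eb : ℕ → Bool)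
          (Z : Type) (_ : AddCommGroup Z)
          (pair : ∀ v : HeightOneSpectrum (𝓞 K),
          galoisCohomology (((W.baseChange K).torsionGaloisModule ((3 ^ 1 : ℕ) : ℤ)).toLocal (Sum.inr v)) 1 →+
          galoisCohomology (((W.baseChange K).torsionGaloisModule ((3 ^ 1 : ℕ) : ℤ)).toLocal (Sum.inr v)) 1 →+ Z)
          (κb : {m : ℕ // Squarefree m ∧ ∀ q ∈ m.primeFactors,
            Zhang2014.IsKolyvaginPrime (W.conductorNorm ℤ) W K 3 q ∧ M + 1 ≤ Zhang2014.kolyvaginIndex W 3 q} →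
          galoisCohomology ((W.baseChange K).torsionGaloisModule ((3 ^ 1 : ℕ) : ℤ)) 1),
          (∀ (m ℓ : ℕ), ℓ.Prime → ¬ ℓ ∣ m → eb (m * ℓ) = !eb m) ∧
          (∀ (s : {m : ℕ // Squarefree m ∧ ∀ q ∈ m.primeFactors,
            Zhang2014.IsKolyvaginPrime (W.conductorNorm ℤ) W K 3 q ∧ M + 1 ≤ Zhang2014.kolyvaginIndex W 3 q})
          (ℓ : ℕ), Zhang2014.IsKolyvaginPrime (W.conductorNorm ℤ) W K 3 ℓ →
          M + 1 ≤ Zhang2014.kolyvaginIndex W 3 ℓ → ¬ ℓ ∣ s.1 →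
          ∀ v : HeightOneSpectrum (𝓞 K), (ℓ : 𝓞 K) ∈ v.asIdeal → ∀ b : Bool,
          Nat.card ((signPart W K τ ((3 ^ 1 : ℕ) : ℤ) (if b then 1 else -1)
              ((selmerF W ((3 ^ 1 : ℕ) : ℤ) 𝒯 (placesDividing K s.1)).relaxedAt {v}).selmerGroup).map
            (galoisCohomology.localization ((W.baseChange K).torsionGaloisModule ((3 ^ 1 : ℕ) : ℤ))
              (Sum.inr v) 1)) = 3 ^ 1) ∧
          (∀ (ℓ : ℕ), Zhang2014.IsKolyvaginPrime (W.conductorNorm ℤ) W K 3 ℓ →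
          M + 1 ≤ Zhang2014.kolyvaginIndex W 3 ℓ → ∀ v : HeightOneSpectrum (𝓞 K), (ℓ : 𝓞 K) ∈ v.asIdeal →
          ∀ (e : ℤ), (e = 1 ∨ e = -1) →
          ∀ (x y : galoisCohomology ((W.baseChange K).torsionGaloisModule ((3 ^ 1 : ℕ) : ℤ)) 1),
          conjAct W τ ((3 ^ 1 : ℕ) : ℤ) x = e • x → conjAct W τ ((3 ^ 1 : ℕ) : ℤ) y = e • y →
          galoisCohomology.localization ((W.baseChange K).torsionGaloisModule ((3 ^ 1 : ℕ) : ℤ)) (Sum.inr v) 1 x ∈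
            𝒯 (Sum.inr v) →
          galoisCohomology.localization ((W.baseChange K).torsionGaloisModule ((3 ^ 1 : ℕ) : ℤ)) (Sum.inr v) 1 y ∈
            (W.baseChange K).kummerSelmerStructure ((3 ^ 1 : ℕ) : ℤ) (Sum.inr v) →
          galoisCohomology.localization ((W.baseChange K).torsionGaloisModule ((3 ^ 1 : ℕ) : ℤ)) (Sum.inr v) 1 x ≠ 0 →
          galoisCohomology.localization ((W.baseChange K).torsionGaloisModule ((3 ^ 1 : ℕ) : ℤ)) (Sum.inr v) 1 y ≠ 0 →
          pair v (galoisCohomology.localization ((W.baseChange K).torsionGaloisModule ((3 ^ 1 : ℕ) : ℤ)) (Sum.inr v) 1 x)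
            (galoisCohomology.localization ((W.baseChange K).torsionGaloisModule ((3 ^ 1 : ℕ) : ℤ)) (Sum.inr v) 1 y) ≠ 0) ∧
          (∀ (s : {m : ℕ // Squarefree m ∧ ∀ q ∈ m.primeFactors,
            Zhang2014.IsKolyvaginPrime (W.conductorNorm ℤ) W K 3 q ∧ M + 1 ≤ Zhang2014.kolyvaginIndex W 3 q})
          (ℓ₀ ℓ : ℕ), Zhang2014.IsKolyvaginPrime (W.conductorNorm ℤ) W K 3 ℓ₀ → M + 1 ≤ Zhang2014.kolyvaginIndex W 3 ℓ₀ →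
          Zhang2014.IsKolyvaginPrime (W.conductorNorm ℤ) W K 3 ℓ → M + 1 ≤ Zhang2014.kolyvaginIndex W 3 ℓ →
          ¬ ℓ₀ ∣ s.1 → ¬ ℓ ∣ s.1 → ℓ ≠ ℓ₀ →
          ∀ v₀ : HeightOneSpectrum (𝓞 K), (ℓ₀ : 𝓞 K) ∈ v₀.asIdeal →
          ∀ v : HeightOneSpectrum (𝓞 K), (ℓ : 𝓞 K) ∈ v.asIdeal → ∀ (b : Bool)
          (a c : galoisCohomology ((W.baseChange K).torsionGaloisModule ((3 ^ 1 : ℕ) : ℤ)) 1),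
          a ∈ signPart W K τ ((3 ^ 1 : ℕ) : ℤ) (if b then 1 else -1)
            ((selmerF W ((3 ^ 1 : ℕ) : ℤ) 𝒯 (placesDividing K s.1)).relaxedAt {v₀}).selmerGroup →
          c ∈ signPart W K τ ((3 ^ 1 : ℕ) : ℤ) (if b then 1 else -1)
            (selmerF W ((3 ^ 1 : ℕ) : ℤ) 𝒯 (placesDividing K (s.1 * ℓ₀ * ℓ))).selmerGroup →
          pair v₀ (galoisCohomology.localization ((W.baseChange K).torsionGaloisModule ((3 ^ 1 : ℕ) : ℤ))
              (Sum.inr v₀) 1 c)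
            (galoisCohomology.localization ((W.baseChange K).torsionGaloisModule ((3 ^ 1 : ℕ) : ℤ))
              (Sum.inr v₀) 1 a) +
          pair v (galoisCohomology.localization ((W.baseChange K).torsionGaloisModule ((3 ^ 1 : ℕ) : ℤ))
              (Sum.inr v) 1 c)
            (galoisCohomology.localization ((W.baseChange K).torsionGaloisModule ((3 ^ 1 : ℕ) : ℤ))
              (Sum.inr v) 1 a) = 0) ∧
          (∀ s, κb s ∈ signPart W K τ ((3 ^ 1 : ℕ) : ℤ) (if eb s.1 then 1 else -1)
          (selmerF W ((3 ^ 1 : ℕ) : ℤ) 𝒯 (placesDividing K s.1)).selmerGroup) ∧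
          (∀ (s s' : {m : ℕ // Squarefree m ∧ ∀ q ∈ m.primeFactors,
            Zhang2014.IsKolyvaginPrime (W.conductorNorm ℤ) W K 3 q ∧ M + 1 ≤ Zhang2014.kolyvaginIndex W 3 q}) (ℓ : ℕ),
          Zhang2014.IsKolyvaginPrime (W.conductorNorm ℤ) W K 3 ℓ → M + 1 ≤ Zhang2014.kolyvaginIndex W 3 ℓ →
          ¬ ℓ ∣ s.1 → s'.1 = s.1 * ℓ → ∀ v : HeightOneSpectrum (𝓞 K), (ℓ : 𝓞 K) ∈ v.asIdeal →
          (galoisCohomology.localization ((W.baseChange K).torsionGaloisModule ((3 ^ 1 : ℕ) : ℤ)) (Sum.inr v) 1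
              (κb s') = 0 ↔
            galoisCohomology.localization ((W.baseChange K).torsionGaloisModule ((3 ^ 1 : ℕ) : ℤ)) (Sum.inr v) 1
              (κb s) = 0)) ∧
          (∀ s, κb s ≠ 0 ↔ ¬ PDiv (D s) 3 (M + 1))))
    (hlev : ∀ (W : WeierstrassCurve ℚ) [W.IsElliptic] [W.IsGloballyMinimal] [NeZero (W.conductorNorm ℤ)]
      (K : Type) [Field K] [NumberField K]
      (Dt : ModularParametrizationData W (W.conductorNorm ℤ)) (β : ℤ) (ι : K →+* ℂ),
      ClassX11b W 3 → ¬ Surj W 3 →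
      IsImaginaryQuadratic K → SatisfiesHeegnerHypothesis (W.conductorNorm ℤ) K →
      Odd (NumberField.discr K) →
      (4 * (W.conductorNorm ℤ : ℤ)) ∣ β ^ 2 - NumberField.discr K → ¬ (3 : ℤ) ∣ Dt.c →
      ∀ (v : HeightOneSpectrum (𝓞 ℚ)) (k n : ℕ) (d : KolyvaginHeegnerData Dt β ι n), Squarefree n →
        (∀ ℓ ∈ n.primeFactors, Zhang2014.IsKolyvaginPrime (W.conductorNorm ℤ) W K 3 ℓ) →
        (if divOrd d 3 < Zhang2014.levelIndex W 3 n then divOrd d 3 else (⊤ : ℕ∞)) < (k : ℕ∞) →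
        padicValNat 3 (W.tamagawaNumberAt v) ≤ k →
        (k : ℕ∞) + (if divOrd d 3 < Zhang2014.levelIndex W 3 n then divOrd d 3 else ⊤) ≤
          Zhang2014.levelIndex W 3 n →
        (padicValNat 3 (W.tamagawaNumberAt v) : ℕ∞) ≤
          (if divOrd d 3 < Zhang2014.levelIndex W 3 n then divOrd d 3 else ⊤)) :
    ∀ (W : WeierstrassCurve ℚ) [W.IsElliptic] [W.IsGloballyMinimal] [NeZero (W.conductorNorm ℤ)]
      (K : Type) [Field K] [NumberField K]
      (Dt : ModularParametrizationData W (W.conductorNorm ℤ)) (β : ℤ) (ι : K →+* ℂ),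
      ClassX11b W 3 → ¬ Surj W 3 →
      IsImaginaryQuadratic K → SatisfiesHeegnerHypothesis (W.conductorNorm ℤ) K →
      Odd (NumberField.discr K) →
      (4 * (W.conductorNorm ℤ : ℤ)) ∣ β ^ 2 - NumberField.discr K → ¬ (3 : ℤ) ∣ Dt.c →
      ∀ (v : HeightOneSpectrum (𝓞 ℚ)) (s : ℕ), s ≤ padicValNat 3 (W.tamagawaNumberAt v) →
        ∀ (n : ℕ) (d : KolyvaginHeegnerData Dt β ι n), Squarefree n →
          (∀ ℓ ∈ n.primeFactors, Zhang2014.IsKolyvaginPrime (W.conductorNorm ℤ) W K 3 ℓ ∧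
            s ≤ Zhang2014.kolyvaginIndex W 3 ℓ) → PDiv d 3 s := by
  haveI : Fact (Nat.Prime 3) := ⟨Nat.prime_three⟩
  refine cornerUpper3_jetchevMax_of_swap_of_perLevel' ?_ hlev
  intro W _ _ _ K _ _ Dt β ι hX hns hK' hHN hodd hβ hc
  obtain ⟨⟨q, hq, hqd, hqN, hqp⟩, hdata, hsup⟩ := hswapIn W K Dt β ι hX hns hK' hHN hodd hβ hc
  refine hswap_of_swapSupply 3 hdata ?_
  intro M e D hall c hcadm hc0
  obtain ⟨τ, hτ, 𝒯, eb, Z, instZ, pair, κb, heb, hPT, hperf, hrec, hκSel, h44c, hκ0⟩ := hsup M e D hall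
  letI : AddCommGroup Z := instZ
  exact exists_deep_of_swapFamilies_of_irr_three' W K 3 Dt β ι rfl hK' hX.2.2.2 hq hqd hqN hqp τ hτ
    1 (M + 1) e le_rfl 𝒯 D eb heb hPT pair hperf hrec κb hκSel h44c hκ0 c hcadm hc0

end Summit.BirchSwinnertonDyer.Rank1Residual.X11b.Three.Koly

end
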